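import Mathlib
import Literature.NumberTheory.LFunctions.WeilExplicit

/-!
# Sketch — first lemmas of the crux ideas for `SignConeOscillatory` (stmt-RiemannHypothesis-16302)

Ideator k = 2, round 1.  Each `def … : Prop` below is the FIRST CHECKABLE STATEMENT of one idea card;
nothing here is proved (crux-ideate stage: the statements must elaborate, not close).

* Card `mellin-side-polar-transfer` : `PolarNodeZetaIdentity` (Euler–Maclaurin paired with `F̂`),
  `PolarMollifierInvariance` (the polar term is Mellin-multiplicative, hence invariant under even
  mollification up to the scalar `R̂(1)`), `HighPassNodeSlack` (p.d. high part relaxes nodes linearly).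
* Card `krein-fake-zero-certificate` : `KreinExtensionOnInterval` (Krein 1940, cite-fact shape) and
  `GapCertificateSuffices` (a pointwise certificate modulo a spectral-gap function proves the
  unit-slack sign-cone inequality at one cutoff).
-/

namespace Summit.RiemannHypothesis.RiemannHypothesis.Cruxes.SignConeOscillatory.IdeaSketch

open scoped BigOperators ComplexConjugate
open MeasureTheory Set Literature.NumberTheory.LFunctions

/-- The additive Fourier transform `F̂(ξ) = ∫ F(u) e^{iξu} du = weilMellin F (1/2 + iξ)`. -/
noncomputable def fhat (F : ℝ → ℂ) (ξ : ℝ) : ℂ :=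
  ∫ u : ℝ, F u * Complex.exp (Complex.I * (ξ : ℂ) * (u : ℂ))

/-- CARD A, first lemma (Euler–Maclaurin paired with `F̂`): for smooth `F` supported in
`(-∞, log N]`, `(1/2π) ∫ F̂(ξ) ζ(1/2+iξ) dξ = Σ_{n ≤ N} n^{-1/2} F(log n) − ∫ F(u) e^{u/2} du`.
(The `N^{1-s}/(s-1)` term of Euler–Maclaurin pairs to `−M_F(1)`, the remainder
`−s ∫_N^∞ B̄₁(x) x^{-s-1} dx` pairs to `∫_N^∞ B̄₁(x) x^{-3/2} (F′ − ½F)(log x) dx = 0`.)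
Consequence: `weilPolarTerm F = 2 F(0) + P₁(F) − (1/π) ∫ F̂ Re ζ(1/2+iξ)` for hermitian `F`. -/
def PolarNodeZetaIdentity : Prop :=
  ∀ (F : ℝ → ℂ) (N : ℕ), 1 ≤ N →
    ContDiff ℝ ((⊤ : ℕ∞) : WithTop ℕ∞) F → HasCompactSupport F →
    tsupport F ⊆ Set.Iic (Real.log N) →
    ∫ ξ : ℝ, fhat F ξ * riemannZeta (1 / 2 + (ξ : ℂ) * Complex.I)
      = 2 * (Real.pi : ℂ) *
        ((∑ n ∈ Finset.Icc 1 N, F (Real.log n) / (Real.sqrt n : ℂ))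
          - ∫ u : ℝ, F u * Complex.exp ((u : ℂ) / 2))

/-- CARD A, second lemma (exact mollifier invariance of the polar term): the polar term is
Mellin-multiplicative, so convolving the test with an EVEN kernel `R` rescales it by
`R̂(1) = ∫ R(v) e^{v/2} dv = ∫ R cosh(v/2)` (`= 1 + O(δ²)` for a mollifier of width `δ`).
Leans on the PROVED tree fact `weilMellin_weilConv_holds`. -/
def PolarMollifierInvariance : Prop :=
  ∀ (F R : ℝ → ℂ), IsWeilTest F → IsWeilTest R → (∀ v : ℝ, R (-v) = R v) →
    weilPolarTerm (weilConv F R) = weilMellin R 1 * weilPolarTerm F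

/-- CARD A, third lemma (linear node slack from the high-pass part): if `R = ρ ⋆ ρ̃` is the
autocorrelation of a probability mollifier `ρ`, then `F − F ⋆ R` is positive-definite whenever
`F` is (spectral density `F̂ (1 − |ρ̂|²) ≥ 0`), hence `|(F − F⋆R)(u)| ≤ (F − F⋆R)(0)` for all `u`:
the mollified test inherits node-nonnegativity up to the LINEAR slack `m_hi = F(0) − (F⋆R)(0)`. -/
def HighPassNodeSlack : Prop :=
  ∀ (k : ℕ) (g : Fin k → ℝ → ℂ) (ρ : ℝ → ℝ),
    (∀ i, IsWeilTest (g i)) → ContDiff ℝ ((⊤ : ℕ∞) : WithTop ℕ∞) ρ → HasCompactSupport ρ →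
    (∀ v, 0 ≤ ρ v) → ∫ v, ρ v = 1 →
    let F : ℝ → ℂ := fun t => ∑ i, weilConv (g i) (weilReflect (g i)) t
    let R : ℝ → ℂ := weilConv (fun v => (ρ v : ℂ)) (weilReflect (fun v => (ρ v : ℂ)))
    let Flo : ℝ → ℂ := weilConv F R
    ∀ u : ℝ, ‖F u - Flo u‖ ≤ (F 0 - Flo 0).re

/-- CARD B, cited fact (M. G. Krein 1940; Sasvári 2006 survey; Krein–Schwartz for distributions):
a continuous function that is positive-definite on the interval `(-2A, 2A)` is, on that interval,
the Fourier transform of a finite positive measure on `ℝ` (i.e. it extends to a positive-definite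
function on all of `ℝ`). -/
def KreinExtensionOnInterval : Prop :=
  ∀ (A : ℝ), 0 < A → ∀ f : ℝ → ℂ, ContinuousOn f (Set.Ioo (-(2 * A)) (2 * A)) →
    (∀ (k : ℕ) (x : Fin k → ℝ) (z : Fin k → ℂ), (∀ i, |x i| < A) →
      0 ≤ (∑ i, ∑ j, (starRingEnd ℂ) (z i) * z j * f (x j - x i)).re ∧
        (∑ i, ∑ j, (starRingEnd ℂ) (z i) * z j * f (x j - x i)).im = 0) →
    ∃ μ : Measure ℝ, IsFiniteMeasure μ ∧
      ∀ x ∈ Set.Ioo (-(2 * A)) (2 * A), f x = ∫ ξ : ℝ, Complex.exp (Complex.I * (x : ℂ) * (ξ : ℂ)) ∂μ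

/-- The explicit spectral kernel of `−(W_ar + δ)` on tests supported in `[−log N, log N]`:
`J_N(ξ) = 2 Re(ζ(1/2+iξ) − Σ_{n≤N} n^{-1/2-iξ}) − Re ψ(1/4 + iξ/2) + log π − 1`
(by `PolarNodeZetaIdentity`, `(1/2π) ∫ F̂ J_N = −(Re W_ar(F) + F(0))` for hermitian `F`). -/
noncomputable def kernelJ (N : ℕ) (ξ : ℝ) : ℝ :=
  2 * (riemannZeta (1 / 2 + (ξ : ℂ) * Complex.I)
        - ∑ n ∈ Finset.Icc 1 N, (n : ℂ) ^ (-(1 / 2 : ℂ) - (ξ : ℂ) * Complex.I)).re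
    - (Complex.digamma (1 / 4 + (ξ : ℂ) / 2 * Complex.I)).re + Real.log Real.pi - 1

/-- CARD B, first lemma of the line (easy direction of the Krein dual): a nonnegative log-integer
cosine comb `c` (fake von Mangoldt weights) plus a real function `H` with SPECTRAL GAP on the
window (it annihilates every `|ĝ|²`, `supp g ⊆ [-a, a]`) that together push `J_N` below zero
pointwise certify the unit-slack sign-cone inequality at cutoff `a` on node-nonnegative tests
(stated here in the Literature vocabulary, definitionally the route's rev-3 Mathlib-primitive
form). -/
def GapCertificateSuffices : Prop :=
  ∀ a : ℝ, 0 < a → ∀ (N : ℕ), Real.exp (2 * a) ≤ N →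
    ∀ (c : ℕ → ℝ) (H : ℝ → ℝ), (∀ n, 0 ≤ c n) →
    (∀ g : ℝ → ℂ, IsWeilTest g → tsupport g ⊆ Set.Icc (-a) a →
        Integrable (fun ξ => (H ξ : ℂ) * ((‖fhat g ξ‖ ^ 2 : ℝ) : ℂ)) ∧
        ∫ ξ : ℝ, H ξ * ‖fhat g ξ‖ ^ 2 = 0) →
    (∀ ξ : ℝ, kernelJ N ξ
        + (∑ n ∈ Finset.Icc 2 N, c n * 2 * Real.cos (ξ * Real.log n) / Real.sqrt n) + H ξ ≤ 0) →
    ∀ (k : ℕ) (g : Fin k → ℝ → ℂ), (∀ i, IsWeilTest (g i) ∧ tsupport (g i) ⊆ Set.Icc (-a) a) →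
      let F : ℝ → ℂ := fun t => ∑ i, weilConv (g i) (weilReflect (g i)) t
      (∀ n : ℕ, 2 ≤ n → 0 ≤ (F (Real.log n)).re) →
        -(F 0).re ≤ (weilPolarTerm F + weilArchTerm F).re

end Summit.RiemannHypothesis.RiemannHypothesis.Cruxes.SignConeOscillatory.IdeaSketch
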